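import Summits.KontsevichZagierPeriods.KontsevichZagierPeriods.Statement
import Literature.NumberTheory.Transcendental.KZKernelConjectureForms
import Mathlib

/-!
# On path (F4) for the rung `NeronTorsionCoset` — line `NeronTorsionCoset`
# (crux `TorsionSectorComplete`, stmt-KontsevichZagierPeriods-14212; route `TorsionLogs`)

`KontsevichZagierPeriods → NeronTorsionCoset`, no sorry, uniform in the base point: the kernel form of the summit
(`kzKernelConjecture_iff_isRational`: every formal combination with `eval = 0` is a relation) applied to the tied
coset element `q²•[rR] − q²•[rI] + (pq)•[rU] + (p² − pq)•[rP] − c•[rB]`, whose evaluation vanishes by the value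
hypothesis (soundness of `eval` on generators, `KZ.eval_of`).  Self-contained copy of the rung's `def` in the
namespace `…NeronTorsionCoset.OnPath`; the skeleton module `Lines/NeronTorsionCoset.lean` carries the same theorem
(`neronTorsionCoset_of_kontsevichZagierPeriods`, `@[aesop safe apply]`) about the registered decl.
-/

namespace Summit.KontsevichZagierPeriods.KontsevichZagierPeriods.Cruxes.TorsionSectorComplete.NeronTorsionCoset.OnPath

open Set MeasureTheory
open Literature.NumberTheory.Transcendental

-- `Summit.KontsevichZagierPeriods.KontsevichZagierPeriods.…` is the tree's mandated layout (single-conjunct summit).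
set_option linter.dupNamespace false
set_option linter.unusedVariables false

/-- The rung (verbatim copy of `Lines/NeronTorsionCoset.lean`). [cite: KontsevichZagier2001, §1.2] -/
def NeronTorsionCoset : Prop :=
  ∀ (g₂ g₃ e₁ xS yS xT xP xR : ℝ) (N a p q : ℕ) (f : ℝ → ℝ),
    (∀ x, f x = 4 * x ^ 3 - g₂ * x - g₃) → g₂ ^ 3 - 27 * g₃ ^ 2 ≠ 0 → f e₁ = 0 → 0 < e₁ →
    (∀ x, e₁ < x → 0 < f x) → e₁ < xS → yS ^ 2 = f xS → 3 ≤ N → 0 < a → 2 * a < N →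
    (∀ hns : (⟨0, 0, 0, -g₂ / 4, -g₃ / 4⟩ : WeierstrassCurve ℝ).toAffine.Nonsingular xS (yS / 2),
      addOrderOf (WeierstrassCurve.Affine.Point.some xS (yS / 2) hns) = N) →
    (N : ℝ) * (∫ x in Set.Ioi xS, (Real.sqrt (f x))⁻¹) = a * (2 * ∫ x in Set.Ioi e₁, (Real.sqrt (f x))⁻¹) →
    Nat.Coprime p q → (q : ℤ) * ((N : ℤ) - 2 * (a : ℤ)) = (p : ℤ) * (2 * (N : ℤ)) →
    e₁ < xT → (xT - e₁) * (xS - e₁) = 3 * e₁ ^ 2 - g₂ / 4 →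
    e₁ ≤ xP → xP ≠ xT →
    xR = (Real.sqrt (f xP) - Real.sqrt (f xT)) ^ 2 / (4 * (xP - xT) ^ 2) - xP - xT → e₁ < xR →
    ∀ (rR rI rU rP : KZ.IntegralRep 2),
    rR.domain = {z | e₁ < z 1 ∧ z 1 < z 0 ∧ z 0 < xR} →
    Set.EqOn rR.integrand (fun z => z 1 / (Real.sqrt (f (z 1)) * Real.sqrt (f (z 0)))) rR.domain →
    rI.domain = {z | e₁ < z 1 ∧ z 1 < z 0 ∧ z 0 < xP} →
    Set.EqOn rI.integrand (fun z => z 1 / (Real.sqrt (f (z 1)) * Real.sqrt (f (z 0)))) rI.domain →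
    rU.domain = {z | xP < z 0 ∧ e₁ < z 1} →
    Set.EqOn rU.integrand
      (fun z => (Real.sqrt (f (z 0)))⁻¹ * ((g₂ * z 1 + 2 * g₃) / (2 * (z 1) ^ 2 * Real.sqrt (f (z 1))))) rU.domain →
    rP.domain = {z | e₁ < z 0 ∧ e₁ < z 1} →
    Set.EqOn rP.integrand
      (fun z => (Real.sqrt (f (z 0)))⁻¹ * ((g₂ * z 1 + 2 * g₃) / (2 * (z 1) ^ 2 * Real.sqrt (f (z 1))))) rP.domain →
    ∀ (c : ℤ) (B : ℝ) (rB : KZ.IntegralRep 1), 1 < B → rB.domain = {t | 1 < t 0 ∧ t 0 < B} →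
    Set.EqOn rB.integrand (fun t => (t 0)⁻¹) rB.domain →
    (q : ℝ) ^ 2 * rR.value - (q : ℝ) ^ 2 * rI.value + (p : ℝ) * q * rU.value + ((p : ℝ) ^ 2 - p * q) * rP.value = c * rB.value →
    ((q : ℤ) ^ 2) • KZ.of rR - ((q : ℤ) ^ 2) • KZ.of rI + ((p : ℤ) * q) • KZ.of rU +
        ((p : ℤ) ^ 2 - p * q) • KZ.of rP - c • KZ.of rB ∈ KZ.relations

/-- **ON PATH.** [cite: KontsevichZagier2001, §1.2] -/
@[aesop safe apply]
theorem neronTorsionCoset_of_kontsevichZagierPeriods (h : _root_.KontsevichZagierPeriods) : NeronTorsionCoset := by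
  have hK : KZKernelConjecture := kzKernelConjecture_iff_isRational.mpr (KontsevichZagierPeriods_iff.mp h)
  intro g₂ g₃ e₁ xS yS xT xP xR N a p q f hf hΔ he₁ he0 hpos hxS hyS hN ha ha2 hord htor hcop hpq hTe hT hP hPT
    hR hRe rR rI rU rP hRd hRi hId hIi hUd hUi hPd hPi c B rB hB hBd hBi hval
  refine hK _ ?_
  simp only [map_sub, map_add, map_zsmul, KZ.eval_of, zsmul_eq_mul, Int.cast_pow, Int.cast_natCast, Int.cast_mul,
    Int.cast_sub]
  linear_combination hval

example : _root_.KontsevichZagierPeriods → NeronTorsionCoset := neronTorsionCoset_of_kontsevichZagierPeriods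

end Summit.KontsevichZagierPeriods.KontsevichZagierPeriods.Cruxes.TorsionSectorComplete.NeronTorsionCoset.OnPath
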